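import Summits.QuantumFields.YangMills.Theorems.BalabanUVNodesN16Exists8UniformScalar
import HarnessLib

/-!
# YM-DAG node N16 (NE3), the re-keyed N07 in-edge — THE BLOCK AVERAGE (42) PRESERVES THE FIRST CHERN NUMBER OF A SCALAR SMALL FIELD, SLICE BY SLICE: the principal
# plaquette angles of `rescale L (bavg L U)` over a `P × P` period square sum to those of `U` over the `LP × LP` square below it (file 4 of the g6 piece; the input of
# the Jensen argument «at rank one, minimisers at uniform-curvature scalar data are uniform», file 5)

Cell `pub-ymgap`, width seat `pub-ymgap-dag-n16-w2` (director-ym №197 ∕ HUMAN RULING D-0149), generation 6.  `--kind proof --supports stmt-QuantumFields-27366 --as helper`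
(K3⁸, KEY MAP v2).  `bears_on: R4∕N16`, edge N07 → N16.  COUNT-NEUTRAL.

HONEST FRAMING.  Kernel bookkeeping over the tree's (42)∕(43) on centre-valued configurations (pub-balaban `T4AveragingDeficitWallBoundary` §1), [Balaban1985Averaging] Prop. 1's
loop-variable bound (`B7Prop2Explicit.norm_Wcx_sub_one_le`), abelian Stokes (`B7Prop1Explicit.stokes`)
and Mathlib's principal representative `toIocMod` on `(−π, π]`.  Nothing of Bałaban is asserted or refuted; DischargeTest `stub_reg910Slot` NOT closed; no K3⁸ v6 stub named or
closed; N16 ∕ N07 NOT discharged; counts UNMOVED (typed 28∕28 · discharged 5∕27 · A 5∕28).  R4 closes the conditional finite-𝕋⁴ rung `BalabanLadder.UV` only; NOT ℝ⁴ ∕ OS ∕ mass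
gap; the YM mass gap (Clay) is NOT proved by any of this.

THE STATEMENT.  A scalar configuration is presented by a REAL potential `A`: `U_A(x,κ) = e^{iA(x,κ)}·1`; its principal `(e_κ,e_μ)`-plaquette angle is
`θ_A(x) := toIocMod 2π (−π) (asum A x (plaqWord κ μ)) ∈ (−π, π]` (`U_A(∂p) = e^{iθ_A}·1`, `1 − Re tr U_A(∂p) = 1 − cos θ_A`).  If `U_A` is `(L·P)`-periodic and in
`SmallField U_A a`, `512(d+1)(d+4)L²a ≤ 1`, then `rescale L (bavg L U_A) = U_B` for the real potential `B(z,κ) = ψ̄(Lz,κ) + A([Lz, Lz + Le_κ])`, `ψ̄` the block mean of the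
PRINCIPAL loop angles of (42) (§2), and ★★ `chern_step`: for every base point `z₀`, `Σ_{i,j<P} θ_B(z₀ + i e_κ + j e_μ) = Σ_{i,j<LP} θ_A(L z₀ + i e_κ + j e_μ)` — the coarse
principal angle at `z` is the boundary combination of the `ψ̄`'s (which TELESCOPES over a period) plus the `L²` fine principal angles of the big square (abelian Stokes; the principal
branches agree in the small-field regime).  (The iterate along (43) under leaf-05's regime is in file 5.)

WHAT IS PROVED ([folklore], 0 `sorry`, 0 `def`; matrix size `n : Type`).  §1 `asum_real_mul_I`, `cexp_toIocMod_mul_I`, `cos_toIocMod`, `abs_toIocMod_le_pi`, `val_hol_plaqWord_real`,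
`wt_hol_plaqWord_real`, `abs_toIocMod_le_two_mul` (`|θ_A| ≤ 2a` on `SmallField U_A a`), `toIocMod_eq_of_cexp_smul_one_eq` (principal angles do not depend on the presentation).
§2 `val_Wcx_real`, `mlog_Wcx_real` (the series log of a scalar loop variable is `i·ψ_r·1`, `ψ_r` the PRINCIPAL loop angle, `|ψ_r| ≤ 32(d+1)(d+4)L²a`), ★ `rescale_bavg_real`.
§3 `sum_range_mul_split`, ★★ `chern_step`.  DEPENDENCES (by name): files 1–3 (`abs_le_two_mul_norm_cexp_smul_one_sub_one`, `isPeriodicCfg_avgIter'`);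
`T4AveragingDeficitWallBoundary` (`scalarCfg`, `val_hol_scalarCfg`, `val_Wcx_scalarCfg`, `wt_expUnit_smul_one`, `mlog_exp_smul_one`, `exp_add_smul_one`); `FederbushMean.cexp_smul_one`;
`T4AveragingDeficitNonAbelian.hol_add_period`; `B7Prop1Explicit` (`asum_plaqWord`, `asum_rectWord`, `stokes`, `Wcx`, `Xavg`, `bavg`); `B7Prop2Explicit.norm_Wcx_sub_one_le`;
`AveragingDeficitTransport.mem_U1_of_unitary`; `MinimalActionClassSixNeg.isUnitaryCfg_scalarCfg_imag`; Mathlib (`toIocMod_eq_self`,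
`toIocMod_add_zsmul`, `toIocMod_add_toIocDiv_zsmul`, `Complex.arg_exp_mul_I`, `Complex.exp_int_mul_two_pi_mul_I`, `Real.cos_add_int_mul_two_pi`, `Finset.sum_range_sub[']`).
-/

open scoped BigOperators Matrix Matrix.Norms.L2Operator
open NormedSpace Finset

namespace Summit.QuantumFields.YangMills.BalabanUVNodes.N16ScalarAverageChern

open Literature.MathematicalPhysics.QuantumFieldTheory.Balaban1983to89
open B7Prop1Explicit B7Prop2Explicit MatrixLog UnitaryModel
open T4AveragingDeficitWall hiding Site Plane Plaq Bond
open T4AveragingDeficitWallBoundary (scalarCfg hol_scalarCfg val_hol_scalarCfg val_Wcx_scalarCfg wt_expUnit_smul_one mlog_exp_smul_one exp_add_smul_one IsPeriodicCfg)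
open FederbushMean (cexp_smul_one norm_smul_one_sub_one norm_smul_one_eq)
open T4AveragingDeficitNonAbelian (hol_add_period)
open Summit.QuantumFields.BalabanUV.T4Continuum
open AveragingDeficitTransport (mem_U1_of_unitary)
open MinimalActionClassSixNeg (isUnitaryCfg_scalarCfg_imag)
open MinimalActionRate (sfClass)
open Summit.QuantumFields.YangMills.BalabanUVNodes.N16Exists8UniformScalar (abs_le_two_mul_norm_cexp_smul_one_sub_one)

noncomputable section

variable {d : ℕ} {n : Type} [Fintype n] [DecidableEq n]

/-! ## §1 Principal plaquette angles of a scalar configuration presented by a real potential -/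

/-- `A(Γ)·i = (iA)(Γ)`: the path functional of the purely imaginary exponent field `iA` is `i` times the real one. [folklore] -/
theorem asum_real_mul_I (A : B7Prop1Explicit.Site d → Fin d → ℝ) :
    ∀ (x : B7Prop1Explicit.Site d) (w : List (Letter d)),
      asum (fun y κ => ((A y κ : ℝ) : ℂ) * Complex.I) x w = ((asum A x w : ℝ) : ℂ) * Complex.I
  | x, [] => by simp
  | x, l :: w => by
    rw [asum_cons, asum_cons, asum_real_mul_I A (x + l.vec) w]
    rcases l with ⟨μ, _ | _⟩
    · simp only [stepA_false]; push_cast; ring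
    · simp only [stepA_true]; push_cast; ring

/-- `e^{i·toIocMod(t)} = e^{it}`. [folklore] -/
theorem cexp_toIocMod_mul_I (t : ℝ) :
    Complex.exp (((toIocMod Real.two_pi_pos (-Real.pi) t : ℝ) : ℂ) * Complex.I) = Complex.exp (((t : ℝ) : ℂ) * Complex.I) := by
  have h := (toIocMod_add_toIocDiv_zsmul Real.two_pi_pos (-Real.pi) t).symm
  set m := toIocDiv Real.two_pi_pos (-Real.pi) t
  conv_rhs => rw [h]
  push_cast
  rw [add_mul, Complex.exp_add]
  have : Complex.exp (((m : ℂ)) * (2 * (Real.pi : ℂ)) * Complex.I) = 1 := by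
    rw [show ((m : ℂ)) * (2 * (Real.pi : ℂ)) * Complex.I = m * (2 * Real.pi * Complex.I) by ring]
    exact Complex.exp_int_mul_two_pi_mul_I m
  rw [zsmul_eq_mul, this, mul_one]

/-- `cos (toIocMod t) = cos t`. [folklore] -/
theorem cos_toIocMod (t : ℝ) : Real.cos (toIocMod Real.two_pi_pos (-Real.pi) t) = Real.cos t := by
  have h := (toIocMod_add_toIocDiv_zsmul Real.two_pi_pos (-Real.pi) t)
  conv_rhs => rw [← h]
  rw [zsmul_eq_mul, Real.cos_add_int_mul_two_pi]

/-- The principal representative lies in `[−π, π]`. [folklore] -/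
theorem abs_toIocMod_le_pi (t : ℝ) : |toIocMod Real.two_pi_pos (-Real.pi) t| ≤ Real.pi := by
  have h := toIocMod_mem_Ioc Real.two_pi_pos (-Real.pi) t
  rw [abs_le]
  constructor <;> linarith [h.1, h.2]

/-- The plaquette variable of `U_A`: `U_A(∂p) = e^{iA(∂p)}·1 = e^{iθ_A}·1`. [folklore] -/
theorem val_hol_plaqWord_real (A : B7Prop1Explicit.Site d → Fin d → ℝ) (x : B7Prop1Explicit.Site d) (κ μ : Fin d) :
    ((hol (scalarCfg (n := n) (fun y ν => ((A y ν : ℝ) : ℂ) * Complex.I)) x (plaqWord κ μ) : (Matrix n n ℂ)ˣ) : Matrix n n ℂ)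
      = Complex.exp (((toIocMod Real.two_pi_pos (-Real.pi) (asum A x (plaqWord κ μ)) : ℝ) : ℂ) * Complex.I) • (1 : Matrix n n ℂ) := by
  rw [val_hol_scalarCfg, asum_real_mul_I, ← cexp_smul_one, cexp_toIocMod_mul_I]

/-- **The Wilson weight reads the principal angle**: `1 − Re tr U_A(∂p) = 1 − cos θ_A(x)`. [cite: Balaban1985Variational, (5) p.278] -/
theorem wt_hol_plaqWord_real [Nonempty n] (A : B7Prop1Explicit.Site d → Fin d → ℝ) (x : B7Prop1Explicit.Site d) (κ μ : Fin d) :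
    wt (hol (scalarCfg (n := n) (fun y ν => ((A y ν : ℝ) : ℂ) * Complex.I)) x (plaqWord κ μ))
      = 1 - Real.cos (toIocMod Real.two_pi_pos (-Real.pi) (asum A x (plaqWord κ μ))) := by
  rw [hol_scalarCfg, asum_real_mul_I, cos_toIocMod]
  exact wt_expUnit_smul_one _

/-- **On the small-field class the principal angles are small**: `SmallField U_A a ⟹ |θ_A(x)| ≤ 2a` (Jordan's inequality). [folklore] -/
theorem abs_toIocMod_le_two_mul [Nonempty n] {A : B7Prop1Explicit.Site d → Fin d → ℝ} {a : ℝ}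
    (hUa : SmallField (scalarCfg (n := n) (fun y ν => ((A y ν : ℝ) : ℂ) * Complex.I)) a) (x : B7Prop1Explicit.Site d) {κ μ : Fin d} (hκμ : κ ≠ μ) :
    |toIocMod Real.two_pi_pos (-Real.pi) (asum A x (plaqWord κ μ))| ≤ 2 * a := by
  have h := hUa x κ μ hκμ
  rw [val_hol_plaqWord_real] at h
  exact (abs_le_two_mul_norm_cexp_smul_one_sub_one (n := n) (abs_toIocMod_le_pi _)).trans (by linarith)

omit [Fintype n] in
/-- **Principal angles do not depend on the presentation**: if `e^{it}·1 = e^{is}·1` then `toIocMod t = toIocMod s`. [folklore] -/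
theorem toIocMod_eq_of_cexp_smul_one_eq [Nonempty n] {t s : ℝ}
    (h : Complex.exp (((t : ℝ) : ℂ) * Complex.I) • (1 : Matrix n n ℂ) = Complex.exp (((s : ℝ) : ℂ) * Complex.I) • (1 : Matrix n n ℂ)) :
    toIocMod Real.two_pi_pos (-Real.pi) t = toIocMod Real.two_pi_pos (-Real.pi) s := by
  obtain ⟨i⟩ := ‹Nonempty n›
  have h1 : Complex.exp (((t : ℝ) : ℂ) * Complex.I) = Complex.exp (((s : ℝ) : ℂ) * Complex.I) := by
    have := congrArg (fun M : Matrix n n ℂ => M i i) h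
    simpa using this
  have ht := Complex.arg_exp_mul_I t
  have hs := Complex.arg_exp_mul_I s
  rw [← ht, ← hs, h1]

/-! ## §2 The series logarithm of a scalar loop variable is `i` times its PRINCIPAL angle; the averaged potential -/

section Average

variable {A : B7Prop1Explicit.Site d → Fin d → ℝ} {a : ℝ} {L : ℕ}

/-- The loop variable of (42) for `U_A`: `U_A(Γ_{c,x_r})U_A(c)⁻¹ = e^{iψ_r}·1` with the PRINCIPAL angle `ψ_r = toIocMod(A(Γ_{c,x_r}) − A(c))`. [cite: Balaban1985Averaging, (42) p.23] -/
theorem val_Wcx_real (L : ℕ) (A : B7Prop1Explicit.Site d → Fin d → ℝ) (q : B7Prop1Explicit.Site d) (κ : Fin d) (r : B7Prop1Explicit.Site d) :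
    ((Wcx L (scalarCfg (n := n) (fun y ν => ((A y ν : ℝ) : ℂ) * Complex.I)) q κ r : (Matrix n n ℂ)ˣ) : Matrix n n ℂ)
      = exp ((((toIocMod Real.two_pi_pos (-Real.pi) (asum A q (gammaWord L κ r) - asum A q (seg κ (L : ℤ))) : ℝ) : ℂ) * Complex.I) • (1 : Matrix n n ℂ)) := by
  rw [val_Wcx_scalarCfg, asum_real_mul_I, asum_real_mul_I, ← cexp_smul_one, ← cexp_smul_one, cexp_toIocMod_mul_I]
  push_cast; ring_nf

/-- **The series logarithm of a scalar loop variable is `i·ψ_r·1`** on the small-field class (`512(d+1)(d+4)L²a ≤ 1`: the loop variable is within `1∕32` of `1` by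
[Balaban1985Averaging] Prop. 1, so `|ψ_r| ≤ 1∕16 < ln 2` by Jordan and the series log (21) inverts `exp`). [cite: Balaban1985Averaging, (21) p.21, (42) p.23] -/
theorem mlog_Wcx_real [Nonempty n] (hL : 1 ≤ L) (ha : 0 ≤ a) (hsmall : 512 * (d + 1) * (d + 4) * (L : ℝ) ^ 2 * a ≤ 1)
    (hUa : SmallField (scalarCfg (n := n) (fun y ν => ((A y ν : ℝ) : ℂ) * Complex.I)) a) (q : B7Prop1Explicit.Site d) (κ : Fin d) (r : Fin d → Fin L) :
    mlog (((Wcx L (scalarCfg (n := n) (fun y ν => ((A y ν : ℝ) : ℂ) * Complex.I)) q κ (boxVec L r) : (Matrix n n ℂ)ˣ) : Matrix n n ℂ))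
      = (((toIocMod Real.two_pi_pos (-Real.pi) (asum A q (gammaWord L κ (boxVec L r)) - asum A q (seg κ (L : ℤ))) : ℝ) : ℂ) * Complex.I) • (1 : Matrix n n ℂ) ∧
    |toIocMod Real.two_pi_pos (-Real.pi) (asum A q (gammaWord L κ (boxVec L r)) - asum A q (seg κ (L : ℤ)))| ≤ 2 * (2 * (8 * (d + 1) * (d + 4) * (L : ℝ) ^ 2 * a)) := by
  set ψ := toIocMod Real.two_pi_pos (-Real.pi) (asum A q (gammaWord L κ (boxVec L r)) - asum A q (seg κ (L : ℤ))) with hψ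
  have hU1 : ∀ x κ', scalarCfg (n := n) (fun y ν => ((A y ν : ℝ) : ℂ) * Complex.I) x κ' ∈ U1 (Matrix n n ℂ) :=
    fun x κ' => mem_U1_of_unitary (isUnitaryCfg_scalarCfg_imag A x κ')
  have hW := norm_Wcx_sub_one_le L hL _ hU1 ha hsmall hUa q κ r
  rw [val_Wcx_real, ← cexp_smul_one] at hW
  have hψle : |ψ| ≤ 2 * (2 * (8 * (d + 1) * (d + 4) * (L : ℝ) ^ 2 * a)) :=
    (abs_le_two_mul_norm_cexp_smul_one_sub_one (n := n) (abs_toIocMod_le_pi _)).trans (by linarith)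
  refine ⟨?_, hψle⟩
  rw [val_Wcx_real]
  apply mlog_exp_smul_one
  rw [Complex.norm_mul, Complex.norm_I, mul_one, Complex.norm_real, Real.norm_eq_abs]
  have hlog : (1 : ℝ) / 2 < Real.log 2 := by have := Real.log_two_gt_d9; linarith
  have hd : (4 : ℝ) ≤ (d + 1) * (d + 4) := by
    have : (0 : ℝ) ≤ d := by positivity
    nlinarith
  have hL1 : (1 : ℝ) ≤ (L : ℝ) ^ 2 := by
    have : (1 : ℝ) ≤ L := by exact_mod_cast hL
    nlinarith
  -- `32(d+1)(d+4)L²a ≤ 1/16`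
  have : 2 * (2 * (8 * (d + 1) * (d + 4) * (L : ℝ) ^ 2 * a)) ≤ 1 / 16 := by nlinarith
  linarith

/-- **★ THE AVERAGED POTENTIAL**: on the small-field class the average (42) of `U_A`, read on the next unit lattice, is the scalar configuration `U_B` with the REAL potential
`B(z,κ) = L^{−d} Σ_r ψ_r(Lz,κ) + A([Lz, Lz + Le_κ])` (`ψ_r` the principal loop angles). [cite: Balaban1985Averaging, (42)–(43) pp.23–24] -/
theorem rescale_bavg_real [Nonempty n] (hL : 1 ≤ L) (ha : 0 ≤ a) (hsmall : 512 * (d + 1) * (d + 4) * (L : ℝ) ^ 2 * a ≤ 1)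
    (hUa : SmallField (scalarCfg (n := n) (fun y ν => ((A y ν : ℝ) : ℂ) * Complex.I)) a) :
    rescale L (bavg L (scalarCfg (n := n) (fun y ν => ((A y ν : ℝ) : ℂ) * Complex.I)))
      = scalarCfg (n := n) (fun z κ => (((∑ r : Fin d → Fin L, ((L : ℝ) ^ d)⁻¹ *
          toIocMod Real.two_pi_pos (-Real.pi) (asum A ((L : ℤ) • z) (gammaWord L κ (boxVec L r)) - asum A ((L : ℤ) • z) (seg κ (L : ℤ))))
          + asum A ((L : ℤ) • z) (seg κ (L : ℤ)) : ℝ) : ℂ) * Complex.I) := by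
  funext z κ
  apply Units.ext
  rw [rescale_apply, bavg, Units.val_mul, val_expUnit, scalarCfg, val_expUnit, val_hol_scalarCfg, asum_real_mul_I]
  have hX : Xavg L (scalarCfg (n := n) (fun y ν => ((A y ν : ℝ) : ℂ) * Complex.I)) ((L : ℤ) • z) κ
      = ((((∑ r : Fin d → Fin L, ((L : ℝ) ^ d)⁻¹ *
          toIocMod Real.two_pi_pos (-Real.pi) (asum A ((L : ℤ) • z) (gammaWord L κ (boxVec L r)) - asum A ((L : ℤ) • z) (seg κ (L : ℤ)))) : ℝ) : ℂ) *
          Complex.I) • (1 : Matrix n n ℂ) := by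
    unfold Xavg
    have hr : ∀ r : Fin d → Fin L, (((L : ℝ) ^ d)⁻¹ : ℝ) •
        mlog (((Wcx L (scalarCfg (n := n) (fun y ν => ((A y ν : ℝ) : ℂ) * Complex.I)) ((L : ℤ) • z) κ (boxVec L r) : (Matrix n n ℂ)ˣ) : Matrix n n ℂ))
        = (((((L : ℝ) ^ d)⁻¹ : ℝ) : ℂ) * ((((toIocMod Real.two_pi_pos (-Real.pi)
            (asum A ((L : ℤ) • z) (gammaWord L κ (boxVec L r)) - asum A ((L : ℤ) • z) (seg κ (L : ℤ)))) : ℝ) : ℂ) * Complex.I)) • (1 : Matrix n n ℂ) := by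
      intro r
      rw [(mlog_Wcx_real (n := n) hL ha hsmall hUa ((L : ℤ) • z) κ r).1, ← Complex.coe_smul, smul_smul]
    rw [Finset.sum_congr rfl fun r _ => hr r, ← Finset.sum_smul]
    congr 1
    push_cast
    rw [Finset.sum_mul]
    refine Finset.sum_congr rfl fun r _ => ?_
    ring
  rw [hX, ← exp_add_smul_one]
  congr 2
  push_cast; ring

end Average

/-! ## §3 The one-step flux identity: the coarse principal angles over a period square sum to the fine ones -/

/-- Splitting a sum over `[0, L·P)` into `P` consecutive windows of length `L`. [folklore] -/
theorem sum_range_mul_split (f : ℕ → ℝ) (L : ℕ) : ∀ P : ℕ, ∑ a ∈ Finset.range (L * P), f a = ∑ i ∈ Finset.range P, ∑ i' ∈ Finset.range L, f (L * i + i')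
  | 0 => by simp
  | P + 1 => by
    rw [Nat.mul_succ, Finset.sum_range_add, sum_range_mul_split f L P, Finset.sum_range_succ]

/-- **★★ THE BLOCK AVERAGE PRESERVES THE FIRST CHERN NUMBER, SLICE BY SLICE.**  Let `U_A` be `(L·P)`-periodic and in `SmallField U_A a`, `512(d+1)(d+4)L²a ≤ 1`, `L, P ≥ 1`,
`κ ≠ μ`.  Then the averaged configuration is `U_B` for a real potential `B`, and for every base point `z₀` the principal `(e_κ,e_μ)`-angles satisfy
`Σ_{i,j<P} θ_B(z₀ + i e_κ + j e_μ) = Σ_{i,j<LP} θ_A(L z₀ + i e_κ + j e_μ)` — the flux through a coarse period square equals the flux through the fine period square below it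
(the boundary means of the principal loop angles telescope over the period; the rest is abelian Stokes, with principal branches agreeing in the small-field regime).
[cite: Balaban1985Averaging, (42)–(44) pp.23–24] -/
theorem chern_step [Nonempty n] {L P : ℕ} (hL : 1 ≤ L) {A : B7Prop1Explicit.Site d → Fin d → ℝ} {a : ℝ} (ha : 0 ≤ a)
    (hsmall : 512 * (d + 1) * (d + 4) * (L : ℝ) ^ 2 * a ≤ 1)
    (hUa : SmallField (scalarCfg (n := n) (fun y ν => ((A y ν : ℝ) : ℂ) * Complex.I)) a)
    (hper : IsPeriodicCfg (scalarCfg (n := n) (fun y ν => ((A y ν : ℝ) : ℂ) * Complex.I)) ((L * P : ℕ) : ℤ)) {κ μ : Fin d} (hκμ : κ ≠ μ) :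
    ∃ B : B7Prop1Explicit.Site d → Fin d → ℝ,
      rescale L (bavg L (scalarCfg (n := n) (fun y ν => ((A y ν : ℝ) : ℂ) * Complex.I))) = scalarCfg (n := n) (fun z ν => ((B z ν : ℝ) : ℂ) * Complex.I) ∧
      ∀ z₀ : B7Prop1Explicit.Site d,
        ∑ i ∈ Finset.range P, ∑ j ∈ Finset.range P,
            toIocMod Real.two_pi_pos (-Real.pi) (asum B (z₀ + (i : ℤ) • e κ + (j : ℤ) • e μ) (plaqWord κ μ))
          = ∑ i ∈ Finset.range (L * P), ∑ j ∈ Finset.range (L * P),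
            toIocMod Real.two_pi_pos (-Real.pi) (asum A ((L : ℤ) • z₀ + (i : ℤ) • e κ + (j : ℤ) • e μ) (plaqWord κ μ)) := by
  -- the block mean of the principal loop angles, and the averaged potential
  set ψb : B7Prop1Explicit.Site d → Fin d → ℝ := fun q ν => ∑ r : Fin d → Fin L, ((L : ℝ) ^ d)⁻¹ *
      toIocMod Real.two_pi_pos (-Real.pi) (asum A q (gammaWord L ν (boxVec L r)) - asum A q (seg ν (L : ℤ))) with hψb
  set B : B7Prop1Explicit.Site d → Fin d → ℝ := fun z ν => ψb ((L : ℤ) • z) ν + asum A ((L : ℤ) • z) (seg ν (L : ℤ)) with hB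
  refine ⟨B, rescale_bavg_real (n := n) hL ha hsmall hUa, fun z₀ => ?_⟩
  have hLr : (0 : ℝ) < (L : ℝ) ^ d := by positivity
  have hd4 : (4 : ℝ) ≤ (d + 1) * (d + 4) := by
    have : (0 : ℝ) ≤ d := by positivity
    nlinarith
  have hL1 : (1 : ℝ) ≤ (L : ℝ) ^ 2 := by
    have : (1 : ℝ) ≤ L := by exact_mod_cast hL
    nlinarith
  -- (a) the block means are bounded by `32(d+1)(d+4)L²a ≤ 1/16`
  have hψb_le : ∀ q ν, |ψb q ν| ≤ 2 * (2 * (8 * (d + 1) * (d + 4) * (L : ℝ) ^ 2 * a)) := by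
    intro q ν
    rw [hψb]
    refine (Finset.abs_sum_le_sum_abs _ _).trans ?_
    have hb : ∀ r : Fin d → Fin L, |((L : ℝ) ^ d)⁻¹ * toIocMod Real.two_pi_pos (-Real.pi) (asum A q (gammaWord L ν (boxVec L r)) - asum A q (seg ν (L : ℤ)))|
        ≤ ((L : ℝ) ^ d)⁻¹ * (2 * (2 * (8 * (d + 1) * (d + 4) * (L : ℝ) ^ 2 * a))) := by
      intro r
      rw [abs_mul, abs_of_pos (inv_pos.mpr hLr)]
      exact mul_le_mul_of_nonneg_left (mlog_Wcx_real (n := n) hL ha hsmall hUa q ν r).2 (inv_pos.mpr hLr).le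
    refine (Finset.sum_le_sum fun r _ => hb r).trans ?_
    rw [Finset.sum_const, Finset.card_univ, Fintype.card_fun, Fintype.card_fin, Fintype.card_fin, nsmul_eq_mul, Nat.cast_pow,
      ← mul_assoc, mul_inv_cancel₀ hLr.ne', one_mul]
  -- (b) the block means are `P`-periodic on the coarse lattice (the loop variables of a periodic configuration are periodic)
  have hψb_per : ∀ (z : B7Prop1Explicit.Site d) (ν ι : Fin d), ψb ((L : ℤ) • (z + (P : ℤ) • e ι)) ν = ψb ((L : ℤ) • z) ν := by
    intro z ν ι
    rw [hψb]
    refine Finset.sum_congr rfl fun r _ => ?_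
    congr 1
    apply toIocMod_eq_of_cexp_smul_one_eq (n := n)
    have e1 : (L : ℤ) • (z + (P : ℤ) • e ι) = (L : ℤ) • z + ((L * P : ℕ) : ℤ) • e ι := by
      rw [smul_add, smul_smul]; push_cast; rfl
    have h1 := val_Wcx_real (n := n) L A ((L : ℤ) • (z + (P : ℤ) • e ι)) ν (boxVec L r)
    have h2 := val_Wcx_real (n := n) L A ((L : ℤ) • z) ν (boxVec L r)
    rw [← cexp_smul_one, cexp_toIocMod_mul_I] at h1 h2
    rw [← h1, ← h2, e1, Wcx, Wcx, hol_add_period hper ι, hol_add_period hper ι]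
  -- (c) the coarse curl of `B`: the boundary combination of the block means plus the fine flux through the big square
  have hcurl : ∀ z : B7Prop1Explicit.Site d, asum B z (plaqWord κ μ)
      = (ψb ((L : ℤ) • z) κ + ψb ((L : ℤ) • (z + e κ)) μ - ψb ((L : ℤ) • (z + e μ)) κ - ψb ((L : ℤ) • z) μ)
        + ∑ i ∈ Finset.range L, ∑ j ∈ Finset.range L, asum A ((L : ℤ) • z + (i : ℤ) • e κ + (j : ℤ) • e μ) (plaqWord κ μ) := by
    intro z
    rw [← stokes, asum_plaqWord]
    simp only [hB]
    rw [asum_rectWord]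
    simp only [smul_add]
    ring
  -- (d) the coarse principal angle EQUALS boundary means + sum of fine principal angles (both sides in `(−π, π]`)
  have hθ : ∀ z : B7Prop1Explicit.Site d, toIocMod Real.two_pi_pos (-Real.pi) (asum B z (plaqWord κ μ))
      = (ψb ((L : ℤ) • z) κ + ψb ((L : ℤ) • (z + e κ)) μ - ψb ((L : ℤ) • (z + e μ)) κ - ψb ((L : ℤ) • z) μ)
        + ∑ i ∈ Finset.range L, ∑ j ∈ Finset.range L,
            toIocMod Real.two_pi_pos (-Real.pi) (asum A ((L : ℤ) • z + (i : ℤ) • e κ + (j : ℤ) • e μ) (plaqWord κ μ)) := by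
    intro z
    rw [hcurl z]
    -- each fine curl = principal angle + integer multiple of 2π
    have hsplit : ∑ i ∈ Finset.range L, ∑ j ∈ Finset.range L, asum A ((L : ℤ) • z + (i : ℤ) • e κ + (j : ℤ) • e μ) (plaqWord κ μ)
        = (∑ i ∈ Finset.range L, ∑ j ∈ Finset.range L,
            toIocMod Real.two_pi_pos (-Real.pi) (asum A ((L : ℤ) • z + (i : ℤ) • e κ + (j : ℤ) • e μ) (plaqWord κ μ)))
          + (∑ i ∈ Finset.range L, ∑ j ∈ Finset.range L,
              toIocDiv Real.two_pi_pos (-Real.pi) (asum A ((L : ℤ) • z + (i : ℤ) • e κ + (j : ℤ) • e μ) (plaqWord κ μ))) • (2 * Real.pi) := by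
      rw [Finset.sum_smul, ← Finset.sum_add_distrib]
      refine Finset.sum_congr rfl fun i _ => ?_
      rw [Finset.sum_smul, ← Finset.sum_add_distrib]
      refine Finset.sum_congr rfl fun j _ => ?_
      exact (toIocMod_add_toIocDiv_zsmul Real.two_pi_pos (-Real.pi) _).symm
    rw [hsplit, ← add_assoc, toIocMod_add_zsmul, toIocMod_eq_self, Set.mem_Ioc]
    -- smallness: `|boundary| ≤ 1/4`, `|Σ θ| ≤ L²·2a ≤ 1/1024`
    have hM : |ψb ((L : ℤ) • z) κ + ψb ((L : ℤ) • (z + e κ)) μ - ψb ((L : ℤ) • (z + e μ)) κ - ψb ((L : ℤ) • z) μ| ≤ 1 / 4 := by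
      have h1 := hψb_le ((L : ℤ) • z) κ
      have h2 := hψb_le ((L : ℤ) • (z + e κ)) μ
      have h3 := hψb_le ((L : ℤ) • (z + e μ)) κ
      have h4 := hψb_le ((L : ℤ) • z) μ
      have hs : 4 * (2 * (2 * (8 * (d + 1) * (d + 4) * (L : ℝ) ^ 2 * a))) ≤ 1 / 4 := by nlinarith
      rw [abs_le] at h1 h2 h3 h4 ⊢
      constructor <;> linarith [h1.1, h1.2, h2.1, h2.2, h3.1, h3.2, h4.1, h4.2]
    have hS : |∑ i ∈ Finset.range L, ∑ j ∈ Finset.range L,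
        toIocMod Real.two_pi_pos (-Real.pi) (asum A ((L : ℤ) • z + (i : ℤ) • e κ + (j : ℤ) • e μ) (plaqWord κ μ))| ≤ (L : ℝ) ^ 2 * (2 * a) := by
      refine (Finset.abs_sum_le_sum_abs _ _).trans ?_
      refine (Finset.sum_le_sum fun i _ => (Finset.abs_sum_le_sum_abs _ _).trans
        (Finset.sum_le_sum fun j _ => abs_toIocMod_le_two_mul (n := n) hUa _ hκμ)).trans ?_
      simp only [Finset.sum_const, Finset.card_range, nsmul_eq_mul]
      nlinarith
    have hS' : (L : ℝ) ^ 2 * (2 * a) ≤ 1 / 1024 := by nlinarith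
    have hπ : (3 : ℝ) < Real.pi := Real.pi_gt_three
    rw [abs_le] at hM hS
    constructor <;> nlinarith [hM.1, hM.2, hS.1, hS.2]
  -- (e) sum over the coarse period square: the boundary means telescope, the fine angles tile
  simp_rw [hθ]
  rw [Finset.sum_congr rfl fun i _ => Finset.sum_add_distrib, Finset.sum_add_distrib]
  have htel : ∑ i ∈ Finset.range P, ∑ j ∈ Finset.range P,
      (ψb ((L : ℤ) • (z₀ + (i : ℤ) • e κ + (j : ℤ) • e μ)) κ + ψb ((L : ℤ) • (z₀ + (i : ℤ) • e κ + (j : ℤ) • e μ + e κ)) μ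
        - ψb ((L : ℤ) • (z₀ + (i : ℤ) • e κ + (j : ℤ) • e μ + e μ)) κ - ψb ((L : ℤ) • (z₀ + (i : ℤ) • e κ + (j : ℤ) • e μ)) μ) = 0 := by
    -- split into the `κ`-telescope (in `j`) and the `μ`-telescope (in `i`)
    have hk : ∀ i ∈ Finset.range P, ∑ j ∈ Finset.range P,
        (ψb ((L : ℤ) • (z₀ + (i : ℤ) • e κ + (j : ℤ) • e μ)) κ - ψb ((L : ℤ) • (z₀ + (i : ℤ) • e κ + (j : ℤ) • e μ + e μ)) κ) = 0 := by
      intro i _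
      have hg : ∀ j : ℕ, ψb ((L : ℤ) • (z₀ + (i : ℤ) • e κ + (j : ℤ) • e μ + e μ)) κ
          = ψb ((L : ℤ) • (z₀ + (i : ℤ) • e κ + ((j + 1 : ℕ) : ℤ) • e μ)) κ := by
        intro j
        have : z₀ + (i : ℤ) • e κ + (j : ℤ) • e μ + e μ = z₀ + (i : ℤ) • e κ + ((j + 1 : ℕ) : ℤ) • e μ := by
          push_cast; rw [add_smul, one_smul, add_assoc]
        rw [this]
      simp_rw [hg]
      rw [Finset.sum_range_sub' (fun j : ℕ => ψb ((L : ℤ) • (z₀ + (i : ℤ) • e κ + (j : ℤ) • e μ)) κ) P]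
      have hPer := hψb_per (z₀ + (i : ℤ) • e κ) κ μ
      simp only [Nat.cast_zero, zero_smul, add_zero]
      rw [hPer, sub_self]
    have hm : ∀ j ∈ Finset.range P, ∑ i ∈ Finset.range P,
        (ψb ((L : ℤ) • (z₀ + (i : ℤ) • e κ + (j : ℤ) • e μ + e κ)) μ - ψb ((L : ℤ) • (z₀ + (i : ℤ) • e κ + (j : ℤ) • e μ)) μ) = 0 := by
      intro j _
      have hg : ∀ i : ℕ, ψb ((L : ℤ) • (z₀ + (i : ℤ) • e κ + (j : ℤ) • e μ + e κ)) μ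
          = ψb ((L : ℤ) • (z₀ + ((i + 1 : ℕ) : ℤ) • e κ + (j : ℤ) • e μ)) μ := by
        intro i
        have : z₀ + (i : ℤ) • e κ + (j : ℤ) • e μ + e κ = z₀ + ((i + 1 : ℕ) : ℤ) • e κ + (j : ℤ) • e μ := by
          push_cast; rw [add_smul, one_smul]; abel
        rw [this]
      simp_rw [hg]
      rw [Finset.sum_range_sub (fun i : ℕ => ψb ((L : ℤ) • (z₀ + (i : ℤ) • e κ + (j : ℤ) • e μ)) μ) P]
      have hPer := hψb_per (z₀ + (j : ℤ) • e μ) μ κ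
      rw [show z₀ + (j : ℤ) • e μ + (P : ℤ) • e κ = z₀ + ((P : ℕ) : ℤ) • e κ + (j : ℤ) • e μ by abel] at hPer
      simp only [Nat.cast_zero, zero_smul, add_zero]
      rw [hPer, sub_self]
    have hre : ∀ i j : ℕ, (ψb ((L : ℤ) • (z₀ + (i : ℤ) • e κ + (j : ℤ) • e μ)) κ + ψb ((L : ℤ) • (z₀ + (i : ℤ) • e κ + (j : ℤ) • e μ + e κ)) μ
        - ψb ((L : ℤ) • (z₀ + (i : ℤ) • e κ + (j : ℤ) • e μ + e μ)) κ - ψb ((L : ℤ) • (z₀ + (i : ℤ) • e κ + (j : ℤ) • e μ)) μ)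
        = (ψb ((L : ℤ) • (z₀ + (i : ℤ) • e κ + (j : ℤ) • e μ)) κ - ψb ((L : ℤ) • (z₀ + (i : ℤ) • e κ + (j : ℤ) • e μ + e μ)) κ)
          + (ψb ((L : ℤ) • (z₀ + (i : ℤ) • e κ + (j : ℤ) • e μ + e κ)) μ - ψb ((L : ℤ) • (z₀ + (i : ℤ) • e κ + (j : ℤ) • e μ)) μ) := by
      intro i j; ring
    simp_rw [hre, Finset.sum_add_distrib]
    rw [Finset.sum_congr rfl hk, Finset.sum_const_zero, zero_add, Finset.sum_comm, Finset.sum_congr rfl hm, Finset.sum_const_zero]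
  rw [htel, zero_add]
  -- tiling: `(i, i') ↦ L i + i'`, `(j, j') ↦ L j + j'`
  simp_rw [sum_range_mul_split _ L P]
  refine Finset.sum_congr rfl fun i _ => ?_
  rw [Finset.sum_comm]
  refine Finset.sum_congr rfl fun i' _ => Finset.sum_congr rfl fun j _ => Finset.sum_congr rfl fun j' _ => ?_
  congr 2
  ext ι'
  simp only [Pi.add_apply, Pi.smul_apply, smul_eq_mul, e_apply]
  split_ifs <;> push_cast <;> ring

end

end Summit.QuantumFields.YangMills.BalabanUVNodes.N16ScalarAverageChern
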